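import Summits.QuantumFields.YangMills.Theorems.ColdStartUniversalityLatticeLangevinWilsonReversibleMeasurable
import HarnessLib

/-!
# Route `ColdStartUniversality` (fixed-cut-off package): DETAILED BALANCE of the SU(2) lattice Langevin dynamics —
# `μ_{β'}(dx) κ_t(x, dy) = μ_{β'}(dy) κ_t(y, dx)`, i.e. the stationary two-time law is exchangeable

Helper file (seat `ym-line-csu-p1`, g15).  The measure-theoretic form of the reversibility of the Shen–Zhu–Zhu semigroup with
respect to the Wilson measure (`integral_mul_transition_symm_su2_of_measurable`): for every Markov kernel family `κ` realising
the transition laws of the SU(2) system on `(ℤ/L)³` at coupling `β'` and every lattice time `t`, the joint law `μ_{β'} ⊗ₘ κ_t` of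
`(U_0, U_t)` under the stationary start `U_0 ∼ μ_{β'}` is invariant under the swap `(x, y) ↦ (y, x)`:

* `compProd_transitionKernel_apply_prod_comm` — `(μ_{β'} ⊗ₘ κ_t)(s ×ˢ s') = (μ_{β'} ⊗ₘ κ_t)(s' ×ˢ s)` on measurable rectangles;
* ★ `map_swap_compProd_transitionKernel` — `(μ_{β'} ⊗ₘ κ_t).map Prod.swap = μ_{β'} ⊗ₘ κ_t` (π-system of rectangles).

SZZ (CMP 400 (2023) §3 p. 13) state the symmetric-Dirichlet-form property without proof; this is its probabilistic reading
(time-reversal invariance of the stationary SZZ process at two times).  THEOREMS ONLY, no definition, no sorry.  RECORD-rung R3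
plumbing (fixed cut-off); nothing here bears on the Yang–Mills mass gap.
-/

set_option autoImplicit false

noncomputable section

namespace Summit.QuantumFields.YangMills.Theorems.ColdStartUniversality

open MeasureTheory ProbabilityTheory Filter Set
open scoped NNReal ENNReal
open Literature.Probability.Process Literature.MathematicalPhysics.QuantumFieldTheory
open Literature.MathematicalPhysics.QuantumLattice (fundamentalRep fundamentalLatticeRep continuous_fundamentalRep)

variable {L : ℕ} [NeZero L]

/-- **Rectangle form of detailed balance**: `(μ_{β'} ⊗ₘ κ_t)(s ×ˢ s') = (μ_{β'} ⊗ₘ κ_t)(s' ×ˢ s)` for measurable `s, s'`, i.e.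
`∫_s κ_t(x, s') dμ_{β'} = ∫_{s'} κ_t(x, s) dμ_{β'}` (`integral_mul_transition_symm_su2_of_measurable` on indicators).
[cite: ShenZhuZhu2022, §3 (Dirichlet form 𝓔^L and its L²(μ)-semigroup P_t^L, after Lemma 3.3, p. 13)] -/
theorem compProd_transitionKernel_apply_prod_comm (L : ℕ) [NeZero L] (β' : ℝ)
    (κ : ℝ≥0 → Kernel (GaugeConfig 3 L (Matrix.specialUnitaryGroup (Fin 2) ℂ))
      (GaugeConfig 3 L (Matrix.specialUnitaryGroup (Fin 2) ℂ))) [∀ t, IsMarkovKernel (κ t)]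
    (hreal : ∀ (t : ℝ≥0) (x : GaugeConfig 3 L (Matrix.specialUnitaryGroup (Fin 2) ℂ))
        (Ω : Type) [MeasurableSpace Ω] (P : Measure Ω) [IsProbabilityMeasure P]
        (W : ℝ≥0 → Ω → (Edge 3 L × NoiseIdx 2 → ℝ)) (hW : IsFlatBrownian W P)
        (U : ℝ≥0 → Ω → GaugeConfig 3 L (Matrix.specialUnitaryGroup (Fin 2) ℂ)),
        (∀ ω, U 0 ω = x) →
        (latticeLangevinDynamics (fundamentalLatticeRep 2) β').IsSolution (fundamentalRep (Fin 2))
          hW.natFiltration P W U →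
        κ t x = P.map (U t))
    (t : ℝ≥0) {s s' : Set (GaugeConfig 3 L (Matrix.specialUnitaryGroup (Fin 2) ℂ))} (hs : MeasurableSet s)
    (hs' : MeasurableSet s') :
    (wilsonMeasure (d := 3) (L := L) (fundamentalRep (Fin 2)) β' ⊗ₘ κ t) (s ×ˢ s') =
      (wilsonMeasure (d := 3) (L := L) (fundamentalRep (Fin 2)) β' ⊗ₘ κ t) (s' ×ˢ s) := by
  classical
  haveI := secondCountableTopology_su2
  haveI := borelSpace_config L
  set μ : Measure (GaugeConfig 3 L (Matrix.specialUnitaryGroup (Fin 2) ℂ)) :=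
    wilsonMeasure (d := 3) (L := L) (fundamentalRep (Fin 2)) β' with hμ
  haveI : IsProbabilityMeasure μ :=
    isProbabilityMeasure_wilsonMeasure (d := 3) (L := L) (fundamentalRep (Fin 2)) (continuous_fundamentalRep (Fin 2)) β'
  -- a rectangle's mass as a real integral of indicators
  have key : ∀ {a b : Set (GaugeConfig 3 L (Matrix.specialUnitaryGroup (Fin 2) ℂ))}, MeasurableSet a → MeasurableSet b →
      (μ ⊗ₘ κ t) (a ×ˢ b) =
        ENNReal.ofReal (∫ x, a.indicator (fun _ => (1 : ℝ)) x * (∫ y, b.indicator (fun _ => (1 : ℝ)) y ∂(κ t x)) ∂μ) := by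
    intro a b ha hb
    rw [Measure.compProd_apply_prod ha hb, ← lintegral_indicator ha]
    -- the integrand is the indicator of `a` times `(κ t x).real b`
    have hpt : ∀ x, a.indicator (fun _ => (1 : ℝ)) x * (∫ y, b.indicator (fun _ => (1 : ℝ)) y ∂(κ t x)) =
        a.indicator (fun x => (κ t x).real b) x := by
      intro x
      rw [integral_indicator_const _ hb, smul_eq_mul, mul_one]
      by_cases hx : x ∈ a
      · rw [indicator_of_mem hx, indicator_of_mem hx, one_mul]
      · rw [indicator_of_notMem hx, indicator_of_notMem hx, zero_mul]
    have hmeas : Measurable fun x => (κ t x).real b :=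
      (Kernel.measurable_coe (κ t) hb).ennreal_toReal
    have hnn : ∀ x, 0 ≤ a.indicator (fun x => (κ t x).real b) x := fun x =>
      Set.indicator_nonneg (fun y _ => measureReal_nonneg) x
    have hbd : ∀ x, a.indicator (fun x => (κ t x).real b) x ≤ 1 := fun x => by
      by_cases hx : x ∈ a
      · rw [indicator_of_mem hx]; exact measureReal_le_one
      · rw [indicator_of_notMem hx]; exact zero_le_one
    have hint : Integrable (fun x => a.indicator (fun x => (κ t x).real b) x) μ :=
      (integrable_const (1 : ℝ)).mono' ((hmeas.indicator ha).aestronglyMeasurable)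
        (ae_of_all _ fun x => by rw [Real.norm_eq_abs, abs_of_nonneg (hnn x)]; exact hbd x)
    simp_rw [hpt]
    rw [ofReal_integral_eq_lintegral_ofReal hint (ae_of_all _ hnn)]
    refine lintegral_congr fun x => ?_
    by_cases hx : x ∈ a
    · rw [indicator_of_mem hx, indicator_of_mem hx, ofReal_measureReal]
    · rw [indicator_of_notMem hx, indicator_of_notMem hx, ENNReal.ofReal_zero]
  rw [key hs hs', key hs' hs]
  congr 1
  exact integral_mul_transition_symm_su2_of_measurable L β' κ hreal t (measurable_const.indicator hs)
    ⟨1, fun x => by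
      by_cases hx : x ∈ s
      · rw [indicator_of_mem hx, abs_one]
      · rw [indicator_of_notMem hx, abs_zero]; exact zero_le_one⟩
    (measurable_const.indicator hs')
    ⟨1, fun x => by
      by_cases hx : x ∈ s'
      · rw [indicator_of_mem hx, abs_one]
      · rw [indicator_of_notMem hx, abs_zero]; exact zero_le_one⟩

/-- ★ **Detailed balance / exchangeability of the stationary two-time law**: `(μ_{β'} ⊗ₘ κ_t).map Prod.swap = μ_{β'} ⊗ₘ κ_t` — the
law of `(U_0, U_t)` for the SU(2) SZZ dynamics started from the Wilson measure is symmetric under time reversal, for every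
`L, β', t` and every realising kernel family. [cite: ShenZhuZhu2022, §3 (p. 13)] -/
theorem map_swap_compProd_transitionKernel (L : ℕ) [NeZero L] (β' : ℝ)
    (κ : ℝ≥0 → Kernel (GaugeConfig 3 L (Matrix.specialUnitaryGroup (Fin 2) ℂ))
      (GaugeConfig 3 L (Matrix.specialUnitaryGroup (Fin 2) ℂ))) [∀ t, IsMarkovKernel (κ t)]
    (hreal : ∀ (t : ℝ≥0) (x : GaugeConfig 3 L (Matrix.specialUnitaryGroup (Fin 2) ℂ))
        (Ω : Type) [MeasurableSpace Ω] (P : Measure Ω) [IsProbabilityMeasure P]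
        (W : ℝ≥0 → Ω → (Edge 3 L × NoiseIdx 2 → ℝ)) (hW : IsFlatBrownian W P)
        (U : ℝ≥0 → Ω → GaugeConfig 3 L (Matrix.specialUnitaryGroup (Fin 2) ℂ)),
        (∀ ω, U 0 ω = x) →
        (latticeLangevinDynamics (fundamentalLatticeRep 2) β').IsSolution (fundamentalRep (Fin 2))
          hW.natFiltration P W U →
        κ t x = P.map (U t))
    (t : ℝ≥0) :
    (wilsonMeasure (d := 3) (L := L) (fundamentalRep (Fin 2)) β' ⊗ₘ κ t).map Prod.swap =
      wilsonMeasure (d := 3) (L := L) (fundamentalRep (Fin 2)) β' ⊗ₘ κ t := by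
  classical
  haveI := secondCountableTopology_su2
  haveI := borelSpace_config L
  set μ : Measure (GaugeConfig 3 L (Matrix.specialUnitaryGroup (Fin 2) ℂ)) :=
    wilsonMeasure (d := 3) (L := L) (fundamentalRep (Fin 2)) β' with hμ
  haveI : IsProbabilityMeasure μ :=
    isProbabilityMeasure_wilsonMeasure (d := 3) (L := L) (fundamentalRep (Fin 2)) (continuous_fundamentalRep (Fin 2)) β'
  haveI : IsProbabilityMeasure (μ ⊗ₘ κ t) := by infer_instance
  haveI : IsFiniteMeasure ((μ ⊗ₘ κ t).map Prod.swap) := by infer_instance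
  refine ext_of_generate_finite _ generateFrom_prod.symm isPiSystem_prod (fun r hr => ?_) ?_
  · obtain ⟨s, hs, s', hs', rfl⟩ := hr
    have hs₀ : MeasurableSet s := hs
    have hs'₀ : MeasurableSet s' := hs'
    rw [Measure.map_apply measurable_swap (hs₀.prod hs'₀), preimage_swap_prod]
    exact (compProd_transitionKernel_apply_prod_comm L β' κ hreal t hs₀ hs'₀).symm
  · rw [Measure.map_apply measurable_swap MeasurableSet.univ, preimage_univ]

end Summit.QuantumFields.YangMills.Theorems.ColdStartUniversality

end
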